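import Summits.ValiantsHypothesis.ValiantsHypothesis.Theorems.KPlusLogSqLawWeakLiftingTowerGraftTwoSidedExchangeSharp

/-!
# Tower graft line — LOWER letters, FAMILY forms by reflection (clustered, commensurable, sharp)

Crux `stmt-ValiantsHypothesis-19561` (`WeakLifting`), line (B) `tower_graft`, two-sided word instrument; seat val-sym-lift-p3 g21,
`--supports 19561`, NO stub claimed.  The reflection `τ ↦ 1/τ` (`reflect_ker`, `reflect_type`, `reflect_same`) turns the lower-currency
hypotheses of the word `Σₗ τ^{γₗ} Pₗ + τ^a J + τ^{a+b} C` (PSD letters BELOW the pivot, `C ⪰ 0` on top, `J` ANY symmetric; exiting type;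
same-scale pairs polarised for the type form `b τ^{a+b} C − Σₗ (a − γₗ) τ^{γₗ} Pₗ`) into the upper-currency hypotheses of
`…TwoSidedSplitFamily` / `…TwoSidedExchangeSharp`, giving the lower FAMILY laws: `card_posType_family_le_rank_clustered_lower` (`≤ rank C`,
`γₗ < a ≤ γₗ + b`), `card_posType_family_le_rank_commensurable_lower` (`≤ rank C + Σ qₗ rank Pₗ`, `γₗ + b qₗ = a`) and
`card_posType_family_le_rank_commensurable_lower_sharp` (`⌊qₗ/2⌋`).  They feed the any-corank census file `…TwoSidedLowerDefiniteAny`.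
HONEST FRAMING: structural laws for one-pivot words; nothing on S4…S5, `TowerB`, `WeakLifting` in its window, Conjecture B, 18050 or
`VP ≠ VNP`.  Def-free.

[folklore] reflection of the split/Loewner certificates.
-/

set_option linter.dupNamespace false
set_option autoImplicit false

namespace Summit.ValiantsHypothesis.ValiantsHypothesis.Theorems.KPlusLogSqLaw.TowerGraft

open Matrix
open scoped BigOperators

namespace TwoSidedThree

/-! ## Reflection `τ ↦ 1/τ`: lower-currency hypotheses become upper-currency hypotheses -/

section Reflect

variable {m : ℕ} {I : Type} {L : ℕ}
variable (C J : Matrix (Fin m) (Fin m) ℝ) (P : Fin L → Matrix (Fin m) (Fin m) ℝ) (a b : ℕ) (γ : Fin L → ℕ)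
  (τ : I → ℝ) (u : I → Fin m → ℝ)

/-- reflected kernel relation: `(C + σ^b J + Σₗ σ^{a+b−γₗ} Pₗ) u = 0` at `σ = τ⁻¹`. [folklore] -/
theorem reflect_ker (hτ : ∀ i, 0 < τ i) (hγ : ∀ l, γ l ≤ a + b)
    (hker : ∀ i, (∑ l, τ i ^ γ l • P l + τ i ^ a • J + τ i ^ (a + b) • C) *ᵥ u i = 0) (i : I) :
    (C + (τ i)⁻¹ ^ b • J + ∑ l, (τ i)⁻¹ ^ (a + b - γ l) • P l) *ᵥ u i = 0 := by
  have hτi : τ i ≠ 0 := ne_of_gt (hτ i)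
  have h := congrArg (fun w => ((τ i)⁻¹) ^ (a + b) • w) (hker i)
  simp only [smul_zero] at h
  rw [← h, ← Matrix.smul_mulVec]
  congr 1
  have e1 : ∀ l, (τ i)⁻¹ ^ (a + b) * τ i ^ γ l = (τ i)⁻¹ ^ (a + b - γ l) := by
    intro l
    obtain ⟨r, hr⟩ := Nat.exists_eq_add_of_le (hγ l)
    rw [hr, Nat.add_sub_cancel_left, pow_add, mul_comm ((τ i)⁻¹ ^ γ l), mul_assoc, ← mul_pow, inv_mul_cancel₀ hτi,
      one_pow, mul_one]
  have e2 : (τ i)⁻¹ ^ (a + b) * τ i ^ a = (τ i)⁻¹ ^ b := by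
    rw [pow_add, mul_assoc, mul_comm ((τ i)⁻¹ ^ b), ← mul_assoc, ← mul_pow, inv_mul_cancel₀ hτi, one_pow, one_mul]
  have e3 : (τ i)⁻¹ ^ (a + b) * τ i ^ (a + b) = 1 := by
    rw [← mul_pow, inv_mul_cancel₀ hτi, one_pow]
  rw [smul_add, smul_add, Finset.smul_sum, smul_smul, smul_smul, e2, e3, one_smul]
  have hs : (∑ l, (τ i)⁻¹ ^ (a + b) • (τ i ^ γ l • P l)) = ∑ l, (τ i)⁻¹ ^ (a + b - γ l) • P l :=
    Finset.sum_congr rfl fun l _ => by rw [smul_smul, e1 l]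
  rw [hs]
  abel

/-- reflected polarised functional: `σₖ^{a+b}·Σₗ (a−γₗ) τₖ^{γₗ} ⟨uᵢ,Pₗuₖ⟩ = Σₗ ((a+b−γₗ) − b) σₖ^{a+b−γₗ} ⟨uᵢ,Pₗuₖ⟩`. [folklore] -/
theorem reflect_sum (hτ : ∀ i, 0 < τ i) (hγ : ∀ l, γ l ≤ a + b) (i k : I) :
    (τ k)⁻¹ ^ (a + b) * ∑ l, ((a - γ l : ℕ) : ℝ) * τ k ^ γ l * (u i ⬝ᵥ (P l *ᵥ u k))
      = ∑ l, ((a + b - γ l - b : ℕ) : ℝ) * (τ k)⁻¹ ^ (a + b - γ l) * (u i ⬝ᵥ (P l *ᵥ u k)) := by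
  have hτk : τ k ≠ 0 := ne_of_gt (hτ k)
  rw [Finset.mul_sum]
  refine Finset.sum_congr rfl fun l _ => ?_
  have hab : a + b - γ l - b = a - γ l := by have := hγ l; omega
  obtain ⟨r, hr⟩ := Nat.exists_eq_add_of_le (hγ l)
  have er : a + b - γ l = r := by omega
  rw [hab, er]
  have epow : (τ k)⁻¹ ^ (a + b) * τ k ^ γ l = (τ k)⁻¹ ^ r := by
    rw [hr, pow_add, mul_assoc, mul_comm ((τ k)⁻¹ ^ r), ← mul_assoc, ← mul_pow, inv_mul_cancel₀ hτk, one_pow, one_mul]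
  rw [← epow]; ring

/-- reflected type: exiting for the lower word = entering for the reflected upper word. [folklore] -/
theorem reflect_type (hτ : ∀ i, 0 < τ i) (hγ : ∀ l, γ l ≤ a + b)
    (htype : ∀ i, ∑ l, ((a - γ l : ℕ) : ℝ) * τ i ^ γ l * (u i ⬝ᵥ (P l *ᵥ u i)) < b * τ i ^ (a + b) * (u i ⬝ᵥ (C *ᵥ u i)))
    (i : I) :
    ∑ l, ((a + b - γ l - b : ℕ) : ℝ) * (τ i)⁻¹ ^ (a + b - γ l) * (u i ⬝ᵥ (P l *ᵥ u i)) < b * (u i ⬝ᵥ (C *ᵥ u i)) := by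
  have hτi := hτ i
  have hpow : 0 < (τ i)⁻¹ ^ (a + b) := pow_pos (inv_pos.mpr hτi) _
  have h1 := mul_lt_mul_of_pos_left (htype i) hpow
  have e3 : (τ i)⁻¹ ^ (a + b) * τ i ^ (a + b) = 1 := by
    rw [← mul_pow, inv_mul_cancel₀ (ne_of_gt hτi), one_pow]
  have e0 : (τ i)⁻¹ ^ (a + b) * ((b : ℝ) * τ i ^ (a + b) * (u i ⬝ᵥ (C *ᵥ u i))) = b * (u i ⬝ᵥ (C *ᵥ u i)) := by
    rw [show (τ i)⁻¹ ^ (a + b) * ((b : ℝ) * τ i ^ (a + b) * (u i ⬝ᵥ (C *ᵥ u i)))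
        = ((τ i)⁻¹ ^ (a + b) * τ i ^ (a + b)) * ((b : ℝ) * (u i ⬝ᵥ (C *ᵥ u i))) by ring, e3, one_mul]
  rw [e0, reflect_sum P a b γ τ u hτ hγ i i] at h1
  exact h1

/-- reflected same-scale polarisation. [folklore] -/
theorem reflect_same (hτ : ∀ i, 0 < τ i) (hγ : ∀ l, γ l ≤ a + b)
    (hsame : ∀ i k, i ≠ k → τ i = τ k →
      (b : ℝ) * τ k ^ (a + b) * (u i ⬝ᵥ (C *ᵥ u k)) = ∑ l, ((a - γ l : ℕ) : ℝ) * τ k ^ γ l * (u i ⬝ᵥ (P l *ᵥ u k)))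
    (i k : I) (hik : i ≠ k) (hστ : (τ i)⁻¹ = (τ k)⁻¹) :
    (b : ℝ) * (u i ⬝ᵥ (C *ᵥ u k)) = ∑ l, ((a + b - γ l - b : ℕ) : ℝ) * (τ k)⁻¹ ^ (a + b - γ l) * (u i ⬝ᵥ (P l *ᵥ u k)) := by
  have hτk := hτ k
  have h := hsame i k hik (inv_injective hστ)
  have e3 : (τ k)⁻¹ ^ (a + b) * τ k ^ (a + b) = 1 := by
    rw [← mul_pow, inv_mul_cancel₀ (ne_of_gt hτk), one_pow]
  rw [← reflect_sum P a b γ τ u hτ hγ i k, ← h]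
  rw [show (τ k)⁻¹ ^ (a + b) * ((b : ℝ) * τ k ^ (a + b) * (u i ⬝ᵥ (C *ᵥ u k)))
      = ((τ k)⁻¹ ^ (a + b) * τ k ^ (a + b)) * ((b : ℝ) * (u i ⬝ᵥ (C *ᵥ u k))) by ring, e3, one_mul]

end Reflect

/-! ## The lower FAMILY laws (scales may repeat; same-scale pairs polarised) -/

section LowerFamily

variable {m : ℕ} {I : Type} [Fintype I] [DecidableEq I] {L : ℕ}
variable (C J : Matrix (Fin m) (Fin m) ℝ) (P : Fin L → Matrix (Fin m) (Fin m) ℝ) (a b : ℕ) (γ q : Fin L → ℕ)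
  (τ : I → ℝ) (u : I → Fin m → ℝ)

/-- **clustered lower letters, FAMILY form**: exiting-type kernel pairs of `Σₗ τ^{γₗ} Pₗ + τ^a J + τ^{a+b} C` with `γₗ < a ≤ γₗ + b`
(scales may repeat, same-scale pairs polarised for the type form `b τ^{a+b} C − Σₗ (a − γₗ) τ^{γₗ} Pₗ`) number at most `rank C`. [folklore] -/
theorem card_posType_family_le_rank_clustered_lower (hC : C.PosSemidef) (hJ : J.IsSymm) (hP : ∀ l, (P l).PosSemidef)
    (hτ : ∀ i, 0 < τ i) (hb : 0 < b) (hγ : ∀ l, γ l < a ∧ a ≤ γ l + b)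
    (hker : ∀ i, (∑ l, τ i ^ γ l • P l + τ i ^ a • J + τ i ^ (a + b) • C) *ᵥ u i = 0)
    (htype : ∀ i, ∑ l, ((a - γ l : ℕ) : ℝ) * τ i ^ γ l * (u i ⬝ᵥ (P l *ᵥ u i)) < b * τ i ^ (a + b) * (u i ⬝ᵥ (C *ᵥ u i)))
    (hsame : ∀ i k, i ≠ k → τ i = τ k →
      (b : ℝ) * τ k ^ (a + b) * (u i ⬝ᵥ (C *ᵥ u k)) = ∑ l, ((a - γ l : ℕ) : ℝ) * τ k ^ γ l * (u i ⬝ᵥ (P l *ᵥ u k))) :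
    Fintype.card I ≤ C.rank := by
  have hγ' : ∀ l, γ l ≤ a + b := fun l => by have := hγ l; omega
  exact card_negType_family_le_rank_clustered C J P b (fun l => a + b - γ l) (fun i => (τ i)⁻¹) u hC hJ hP
    (fun i => inv_pos.mpr (hτ i)) hb (fun l => by have := hγ l; omega)
    (reflect_ker C J P a b γ τ u hτ hγ' hker) (reflect_type C P a b γ τ u hτ hγ' htype)
    (fun i k hik hστ => reflect_same C P a b γ τ u hτ hγ' hsame i k hik hστ)

/-- **lower letters at gaps that are multiples of the top gap, FAMILY form**: exiting-type kernel pairs of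
`Σₗ τ^{γₗ} Pₗ + τ^a J + τ^{a+b} C` with `γₗ + b qₗ = a`, `qₗ ≥ 1` number at most `rank C + Σₗ qₗ rank Pₗ`. [folklore] -/
theorem card_posType_family_le_rank_commensurable_lower (hC : C.PosSemidef) (hJ : J.IsSymm) (hP : ∀ l, (P l).PosSemidef)
    (hτ : ∀ i, 0 < τ i) (hb : 0 < b) (hq : ∀ l, 1 ≤ q l) (hγ : ∀ l, γ l + b * q l = a)
    (hker : ∀ i, (∑ l, τ i ^ γ l • P l + τ i ^ a • J + τ i ^ (a + b) • C) *ᵥ u i = 0)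
    (htype : ∀ i, ∑ l, ((a - γ l : ℕ) : ℝ) * τ i ^ γ l * (u i ⬝ᵥ (P l *ᵥ u i)) < b * τ i ^ (a + b) * (u i ⬝ᵥ (C *ᵥ u i)))
    (hsame : ∀ i k, i ≠ k → τ i = τ k →
      (b : ℝ) * τ k ^ (a + b) * (u i ⬝ᵥ (C *ᵥ u k)) = ∑ l, ((a - γ l : ℕ) : ℝ) * τ k ^ γ l * (u i ⬝ᵥ (P l *ᵥ u k))) :
    Fintype.card I ≤ C.rank + ∑ l, q l * (P l).rank := by
  have hγ' : ∀ l, γ l ≤ a + b := fun l => by have := hγ l; omega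
  exact card_negType_family_le_rank_commensurable C J P b (fun l => a + b - γ l) (fun i => (τ i)⁻¹) u q hC hJ hP
    (fun i => inv_pos.mpr (hτ i)) hb hq (fun l => by have := hγ l; rw [Nat.mul_succ]; omega)
    (reflect_ker C J P a b γ τ u hτ hγ' hker) (reflect_type C P a b γ τ u hτ hγ' htype)
    (fun i k hik hστ => reflect_same C P a b γ τ u hτ hγ' hsame i k hik hστ)

/-- the same with the SHARP constant `⌊qₗ/2⌋`. [folklore] -/
theorem card_posType_family_le_rank_commensurable_lower_sharp (hC : C.PosSemidef) (hJ : J.IsSymm) (hP : ∀ l, (P l).PosSemidef)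
    (hτ : ∀ i, 0 < τ i) (hb : 0 < b) (hq : ∀ l, 1 ≤ q l) (hγ : ∀ l, γ l + b * q l = a)
    (hker : ∀ i, (∑ l, τ i ^ γ l • P l + τ i ^ a • J + τ i ^ (a + b) • C) *ᵥ u i = 0)
    (htype : ∀ i, ∑ l, ((a - γ l : ℕ) : ℝ) * τ i ^ γ l * (u i ⬝ᵥ (P l *ᵥ u i)) < b * τ i ^ (a + b) * (u i ⬝ᵥ (C *ᵥ u i)))
    (hsame : ∀ i k, i ≠ k → τ i = τ k →
      (b : ℝ) * τ k ^ (a + b) * (u i ⬝ᵥ (C *ᵥ u k)) = ∑ l, ((a - γ l : ℕ) : ℝ) * τ k ^ γ l * (u i ⬝ᵥ (P l *ᵥ u k))) :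
    Fintype.card I ≤ C.rank + ∑ l, (q l / 2) * (P l).rank := by
  have hγ' : ∀ l, γ l ≤ a + b := fun l => by have := hγ l; omega
  exact card_negType_family_le_rank_commensurable_sharp C J P b (fun l => a + b - γ l) q (fun i => (τ i)⁻¹) u hC hJ hP
    (fun i => inv_pos.mpr (hτ i)) hb hq (fun l => by have := hγ l; rw [Nat.mul_succ]; omega)
    (reflect_ker C J P a b γ τ u hτ hγ' hker) (reflect_type C P a b γ τ u hτ hγ' htype)
    (fun i k hik hστ => reflect_same C P a b γ τ u hτ hγ' hsame i k hik hστ)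

end LowerFamily

end TwoSidedThree

end Summit.ValiantsHypothesis.ValiantsHypothesis.Theorems.KPlusLogSqLaw.TowerGraft
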